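import Summits.QuantumFields.YangMills.Theorems.FemtoCutoffLadderFixedLatticeLawInnerRateCopies
import Summits.QuantumFields.YangMills.Theorems.LuscherReductionRunningReductionValleyAxial
import HarnessLib

/-!
# INNER NO-INTRUDER WITH RATE: the AXIAL form carries the rate (crux `FixedLatticeLaw` stmt-QuantumFields-23943 ≡ leaf `FemtoGapFixedLattice`,
# route `FemtoCutoffLadder`; the `O(λ_b²)` twin of route RED's `innerNoIntruderOneOrbitAt_of_axial`, `…RunningReductionValleyAxial`)

Lead seat `ym-line-fcl-p1` g2 (2026-08-28).  RED's C4 provers work with the axial kernel `A_β` on the comb box (COARSE-DESIGN §10–§11,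
`InnerNoIntruderAxialAt`); the passage axial → one-orbit is an EXACT change of variables (`qform_eq_axial`, `l2_eq_axial`), so any tolerance is
carried verbatim.  ★ `innerOneOrbitRate_of_axialRate` (level `k`): the axial comparison with tolerance `e^{C·λ_b(L³β)²}` gives the one-orbit
comparison with the same tolerance; with `innerRate_of_oneOrbitRate` (`…InnerRateCopies`) and the landed endgame (`…RateGlue`) an axial-gauge
Born–Oppenheimer comparison with an `O(λ_b²)` tolerance closes the registered `stub_innerRate` of crux 23943.
HONEST FRAMING: bookkeeping; the axial comparison with rate is OPEN (XL); femto rung R2b1 (RECORD label) — not a mass gap, not Clay.  No `sorry`.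
-/

set_option autoImplicit false

noncomputable section

open MeasureTheory Filter Topology Real
open scoped BigOperators
open Literature.MathematicalPhysics.QuantumFieldTheory hiding SU2
open Literature.MathematicalPhysics.QuantumLattice

namespace Summit.QuantumFields.YangMills.Theorems.FemtoCutoffLadder

open Summit.QuantumFields.YangMills.Theorems.FemtoTransferGap

variable {L : ℕ} [NeZero L]

/-- ★ **One-orbit INNER NO-INTRUDER WITH RATE from its AXIAL form** (level `k`): RED's `innerNoIntruderOneOrbitAt_of_axial` is an exact change of
variables (`qform_eq_axial`, `l2_eq_axial`), so the tolerance is carried verbatim — here `e^{C·λ_b(L³β)²}`.  A C4 prover working with the axial kernel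
`A_β` on the comb box (COARSE-DESIGN §10–§11) who proves the comparison with an `O(λ_b²)` tolerance closes `stub_innerRate` through this and
`innerRate_of_oneOrbitRate`. [cite: SeilerLNP1982, §3] [cite: Luscher1983, §3] -/
theorem innerOneOrbitRate_of_axialRate (k : ℕ) {δ : ℝ → ℝ}
    (hI : ∃ C β0 : ℝ, ∀ β : ℝ, β0 ≤ β →
      ∀ g : Fin (k + 1) → ((OffIdx L → SU2) → ℝ),
        (∀ i, Measurable (g i)) → (∀ i, ∃ C' : ℝ, ∀ w, |g i w| ≤ C') →
        (∀ i (k' : SU2) (w : OffIdx L → SU2), g i (fun j => k' * w j * k'⁻¹) = g i w) →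
        (∀ i w, g i w ≠ 0 → ∀ j : OffIdx L, frobNorm ((w j : Matrix (Fin 2) (Fin 2) ℂ) - 1) ≤ (6 * L + 1) * δ β) →
        (∀ a : Fin (k + 1) → ℝ, a ≠ 0 → 0 < ∫ w, (∑ i, a i * g i w) * (∑ i, a i * g i w) ∂(Measure.pi fun _ : OffIdx L => haarProbability SU2)) →
          ∃ a : Fin (k + 1) → ℝ, a ≠ 0 ∧
            (∫ w, ∫ w', (∑ i, a i * g i w) * axialKernel β w w' * (∑ i, a i * g i w')
                ∂(Measure.pi fun _ : OffIdx L => haarProbability SU2) ∂(Measure.pi fun _ : OffIdx L => haarProbability SU2)) *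
              levelValue su2Rep 1 ((L : ℝ) ^ 3 * β) 0 ≤
            Real.exp (C * bareLambda ((L : ℝ) ^ 3 * β) ^ 2) * levelValue su2Rep 1 ((L : ℝ) ^ 3 * β) k * levelValue su2Rep L β 0 *
              ∫ w, (∑ i, a i * g i w) * (∑ i, a i * g i w) ∂(Measure.pi fun _ : OffIdx L => haarProbability SU2)) :
    ∃ C βI : ℝ, ∀ β : ℝ, βI ≤ β →
      ∀ G : Fin (k + 1) → (GaugeConfig 3 L SU2 → ℝ),
        (∀ i, Measurable (G i)) → (∀ i, ∃ C' : ℝ, ∀ U, |G i U| ≤ C') →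
        (∀ i (g : Site 3 L → SU2) (U : GaugeConfig 3 L SU2), G i (gaugeTransform g U) = G i U) →
        (∀ i U, G i U ≠ 0 → orbitDist U < δ β) →
        (∀ a : Fin (k + 1) → ℝ, a ≠ 0 → 0 < l2 (fun U => ∑ i, a i * G i U) (fun U => ∑ i, a i * G i U)) →
          ∃ a : Fin (k + 1) → ℝ, a ≠ 0 ∧
            qform su2Rep β (fun U => ∑ i, a i * G i U) (fun U => ∑ i, a i * G i U) * levelValue su2Rep 1 ((L : ℝ) ^ 3 * β) 0 ≤
              Real.exp (C * bareLambda ((L : ℝ) ^ 3 * β) ^ 2) * levelValue su2Rep 1 ((L : ℝ) ^ 3 * β) k * levelValue su2Rep L β 0 *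
                l2 (fun U => ∑ i, a i * G i U) (fun U => ∑ i, a i * G i U) := by
  obtain ⟨C, β0, hβ0⟩ := hI
  refine ⟨C, max β0 0, fun β hβ G hGm hGb hGg hGs hGram => ?_⟩
  have hβ' : β0 ≤ β := (le_max_left _ _).trans hβ
  have hβ0' : 0 ≤ β := (le_max_right _ _).trans hβ
  -- the axial family (RED's change of variables, verbatim)
  set g : Fin (k + 1) → (OffIdx L → SU2) → ℝ := fun i w => G i (glue w) with hgdef
  have hgm : ∀ i, Measurable (g i) := fun i => (hGm i).comp measurable_glue
  have hgb : ∀ i, ∃ C' : ℝ, ∀ w, |g i w| ≤ C' := fun i => by obtain ⟨C', hC'⟩ := hGb i; exact ⟨C', fun w => hC' _⟩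
  have hgA : ∀ i (k' : SU2) (w : OffIdx L → SU2), g i (fun j => k' * w j * k'⁻¹) = g i w := fun i k' w => glue_comp_conj (hGg i) k' w
  have hgs : ∀ i w, g i w ≠ 0 → ∀ j : OffIdx L, frobNorm ((w j : Matrix (Fin 2) (Fin 2) ℂ) - 1) ≤ (6 * L + 1) * δ β :=
    fun i w hw j => glue_support_of_orbitDist (hGs i) hw j
  choose Cb hCb using hGb
  have hcomb : ∀ a : Fin (k + 1) → ℝ,
      (Measurable fun U => ∑ i, a i * G i U) ∧ (∀ U, |∑ i, a i * G i U| ≤ ∑ i, |a i| * Cb i) ∧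
      (∀ (g' : Site 3 L → SU2) (U : GaugeConfig 3 L SU2), (∑ i, a i * G i (gaugeTransform g' U)) = ∑ i, a i * G i U) := by
    intro a
    refine ⟨Finset.measurable_sum _ fun i _ => (hGm i).const_mul _, fun U => ?_, fun g' U => Finset.sum_congr rfl fun i _ => by rw [hGg i]⟩
    refine (Finset.abs_sum_le_sum_abs _ _).trans (Finset.sum_le_sum fun i _ => ?_)
    rw [abs_mul]; exact mul_le_mul_of_nonneg_left (hCb i U) (abs_nonneg _)
  have hl2 : ∀ a : Fin (k + 1) → ℝ, l2 (fun U => ∑ i, a i * G i U) (fun U => ∑ i, a i * G i U) =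
      ∫ w, (∑ i, a i * g i w) * (∑ i, a i * g i w) ∂(Measure.pi fun _ : OffIdx L => haarProbability SU2) := fun a => by
    obtain ⟨hm, -, hg'⟩ := hcomb a
    exact l2_eq_axial hm hg'
  have hq : ∀ a : Fin (k + 1) → ℝ, qform su2Rep β (fun U => ∑ i, a i * G i U) (fun U => ∑ i, a i * G i U) =
      ∫ w, ∫ w', (∑ i, a i * g i w) * axialKernel β w w' * (∑ i, a i * g i w')
        ∂(Measure.pi fun _ : OffIdx L => haarProbability SU2) ∂(Measure.pi fun _ : OffIdx L => haarProbability SU2) := fun a => by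
    obtain ⟨hm, hb, hg'⟩ := hcomb a
    exact qform_eq_axial hβ0' hm hb hg'
  have hGram' : ∀ a : Fin (k + 1) → ℝ, a ≠ 0 →
      0 < ∫ w, (∑ i, a i * g i w) * (∑ i, a i * g i w) ∂(Measure.pi fun _ : OffIdx L => haarProbability SU2) := fun a ha => by
    rw [← hl2 a]; exact hGram a ha
  obtain ⟨a, ha, hIa⟩ := hβ0 β hβ' g hgm hgb hgA hgs hGram'
  refine ⟨a, ha, ?_⟩
  rw [hq a, hl2 a]
  exact hIa

end Summit.QuantumFields.YangMills.Theorems.FemtoCutoffLadder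

end
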